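/-
Copyright (c) 2026. All rights reserved.
Released under Apache 2.0 license as described in the file LICENSE.
Authors: abc-iut cell, campaign-S prover seat abc-iut-S1 (gen 2).
-/
import Literature.IUT.LogVolume.TensorPacketUnramified
import HarnessLib

/-!
# The local different through the local trace form: `𝔪^n ∣ 𝔇_{𝒪_K/ℤ_p} ⟺ Tr_{K/ℚ_p}(𝔪^{−n}·𝒪_K) ⊆ ℤ_p`, and `d = δ/e`

Companion of `IntegerRing.lean` / `FundamentalIdentity.lean` (abc-iut-S1: `different p K = differentIdeal ℤ_[p] 𝒪_K`,
`differentOrd p K`, `exists_different_eq_maximalIdeal_pow`), for a mixed-characteristic nonarchimedean local field `K`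
in the norm-side presentation of [IUTchIV] §1 (`[NormedAlgebra ℚ_[p] K] [IsUltrametricDist K] [ProperSpace K]`).
THEOREMS ONLY:

* `dvd_different_iff_trace` — Serre, *Local Fields*, Ch. III §3 Prop. 7 (with `𝔞 = A`) for `𝒪_K/ℤ_p`:
  `I ∣ 𝔇 ⟺ Tr_{K/ℚ_p}(I⁻¹) ⊆ ℤ_p` (Mathlib `differentialIdeal_le_iff` with abc-iut-S1's scoped instances);
* `mem_inv_coeIdeal_iff_norm` — `x ∈ I⁻¹ ⟺ ‖b·x‖ ≤ 1` for all `b ∈ I`;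
* **`pow_maximalIdeal_dvd_different_iff_trace`** — `𝔪_K^n ∣ 𝔇_{𝒪_K/ℤ_p}` iff every `z ∈ K` with `‖b·z‖ ≤ 1` for all
  `b ∈ 𝔪_K^n` (i.e. `z ∈ 𝔪_K^{−n}`) satisfies `‖Tr_{K/ℚ_p}(z·y)‖ ≤ 1` for all `‖y‖ ≤ 1` — the LOCAL side of Serre III §4
  Prop. 10 in exactly the shape of `Literature.NumberTheory.NumberFields.pow_dvd_differentIdeal_iff_local`
  (`DifferentCompletionExponent.lean`: the exponent of a prime `𝔓` of a number field `L` in `𝔇_{𝓞L/𝓞K}` equals the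
  exponent for which this local condition holds in `L_𝔓/K_𝔭`);
* **`div_le_differentOrd_iff_pow_dvd`**, **`div_le_differentOrd_iff_trace`** — `n/e ≤ d ⟺ 𝔪_K^n ∣ 𝔇 ⟺` the trace
  condition: the normalised order `d = differentOrd p K` (`ord(p) = 1`, [IUTchIV] Prop. 1.1 p. 9: "`d_i` the order of
  any generator of the different ideal") is `δ/e` with `δ = max {n : 𝔪^n ∣ 𝔇}`.

With `pow_dvd_differentIdeal_iff_local` this gives, for `K = L_𝔓` presented as such a field over `ℚ_p`
(e.g. abc-iut-S7's `RescaledCompletion`), `d_𝔓 = differentOrd p L_𝔓 = (exponent of 𝔓 in 𝔇_{𝓞L/ℤ}) / e(𝔓|p)` — the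
identification of [IUTchIV] Def. 1.9's `log(𝔡^L_𝔓) := deg_𝔓(𝔡^L_ADiv)` (p. 23) with `[L_𝔓:ℚ_p]·d_𝔓·log p` — once the
traces `Tr_{L_𝔓/ℚ_p}` and `Tr_{L_𝔓/ℚ_𝔭}` (`ℚ_p ≅ ℚ_𝔭`, the completion of `ℚ` at `p`) are matched (not done here).
Classical (Serre III §3–§4); the [IUTchIV] locators record what the text prints; nothing here bears on the disputed
[IUTchIII] Cor. 3.12.
-/

noncomputable section

open Metric Set IsLocalRing
open scoped NormedField nonZeroDivisors

namespace Literature.IUT.LogVolume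

variable (p : ℕ) [Fact p.Prime]
variable (K : Type*) [NontriviallyNormedField K] [instK : NormedAlgebra ℚ_[p] K] [IsUltrametricDist K]
  [ProperSpace K]

/-- The range of `ℤ_p → ℚ_p` is the closed unit ball. [folklore] -/
private theorem mem_range_padicInt_iff (x : ℚ_[p]) : x ∈ (algebraMap ℤ_[p] ℚ_[p]).range ↔ ‖x‖ ≤ 1 :=
  ⟨fun ⟨y, hy⟩ ↦ hy ▸ y.2, fun h ↦ ⟨⟨x, h⟩, rfl⟩⟩

/-- **Serre III §3 Prop. 7 for `𝒪_K/ℤ_p`**: a nonzero ideal `I ⊆ 𝒪_K` divides the different `𝔇_{𝒪_K/ℤ_p}` iff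
`Tr_{K/ℚ_p}(I⁻¹) ⊆ ℤ_p` (Mathlib `differentialIdeal_le_iff`). [cite: SerreLocalFields1979, Ch. III §4 Prop. 10] -/
theorem dvd_different_iff_trace {I : Ideal (Valued.integer K)} (hI : I ≠ ⊥) :
    I ∣ different p K ↔
      ∀ x ∈ ((I : FractionalIdeal (Valued.integer K)⁰ K)⁻¹ : FractionalIdeal (Valued.integer K)⁰ K),
        ‖Algebra.trace ℚ_[p] K x‖ ≤ 1 := by
  haveI := finiteDimensional p K
  haveI := isFractionRing_integer p K
  haveI : Algebra.IsSeparable ℚ_[p] K := inferInstance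
  rw [different_eq, Ideal.dvd_iff_le, differentialIdeal_le_iff (A := ℤ_[p]) (K := ℚ_[p]) (L := K) hI,
    Submodule.map_le_iff_le_comap]
  constructor
  · intro h x hx
    have := h hx
    rw [Submodule.mem_comap, Submodule.mem_one] at this
    obtain ⟨a, ha⟩ := this
    exact (mem_range_padicInt_iff p _).mp ⟨a, ha⟩
  · intro h x hx
    rw [Submodule.mem_comap, Submodule.mem_one]
    obtain ⟨a, ha⟩ := (mem_range_padicInt_iff p _).mpr (h x hx)
    exact ⟨a, ha⟩

include instK in
/-- Membership in the inverse of (the fractional ideal of) a nonzero ideal `I ⊆ 𝒪_K`: `x ∈ I⁻¹ ⟺ ‖b·x‖ ≤ 1` for all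
`b ∈ I`. [cite: SerreLocalFields1979, Ch. III §4 Prop. 10] -/
theorem mem_inv_coeIdeal_iff_norm {I : Ideal (Valued.integer K)} (hI : I ≠ ⊥) (x : K) :
    x ∈ ((I : FractionalIdeal (Valued.integer K)⁰ K)⁻¹ : FractionalIdeal (Valued.integer K)⁰ K) ↔
      ∀ b ∈ I, ‖(b : K) * x‖ ≤ 1 := by
  haveI := isFractionRing_integer p K
  have hI0 : (I : FractionalIdeal (Valued.integer K)⁰ K) ≠ 0 := by simpa using hI
  rw [FractionalIdeal.mem_inv_iff hI0]
  constructor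
  · intro h b hb
    obtain ⟨c, hc⟩ := (FractionalIdeal.mem_one_iff (Valued.integer K)⁰).mp
      (h _ (FractionalIdeal.mem_coeIdeal_of_mem (Valued.integer K)⁰ hb))
    rw [mul_comm, ← show ((c : K)) = x * (b : K) from hc]
    exact c.2
  · intro h y hy
    obtain ⟨b, hb, rfl⟩ := (FractionalIdeal.mem_coeIdeal (Valued.integer K)⁰).mp hy
    refine (FractionalIdeal.mem_one_iff (Valued.integer K)⁰).mpr ⟨⟨x * (b : K), ?_⟩, rfl⟩
    have := h b hb
    rwa [mul_comm] at this

/-- **The local criterion**: `𝔪_K^n ∣ 𝔇_{𝒪_K/ℤ_p}` iff every `z ∈ 𝔪_K^{−n}` (i.e. `‖b·z‖ ≤ 1` for all `b ∈ 𝔪_K^n`)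
pairs `𝒪_K` into `ℤ_p` under the trace form: `‖Tr_{K/ℚ_p}(z·y)‖ ≤ 1` for all `‖y‖ ≤ 1` — the local side of
«the different is preserved by completion». [cite: SerreLocalFields1979, Ch. III §4 Prop. 10] -/
theorem pow_maximalIdeal_dvd_different_iff_trace (n : ℕ) :
    maximalIdeal (Valued.integer K) ^ n ∣ different p K ↔
      ∀ z : K, (∀ b ∈ maximalIdeal (Valued.integer K) ^ n, ‖(b : K) * z‖ ≤ 1) →
        ∀ y : K, ‖y‖ ≤ 1 → ‖Algebra.trace ℚ_[p] K (z * y)‖ ≤ 1 := by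
  have hIbot : maximalIdeal (Valued.integer K) ^ n ≠ ⊥ :=
    pow_ne_zero _ (IsDiscreteValuationRing.not_a_field (Valued.integer K))
  rw [dvd_different_iff_trace p K hIbot]
  constructor
  · intro h z hz y hy
    refine h (z * y) ((mem_inv_coeIdeal_iff_norm p K hIbot _).mpr fun b hb ↦ ?_)
    rw [← mul_assoc, norm_mul]
    exact mul_le_one₀ (hz b hb) (norm_nonneg _) hy
  · intro h x hx
    have := h x ((mem_inv_coeIdeal_iff_norm p K hIbot x).mp hx) 1 (by simp)
    rwa [mul_one] at this

/-- **`n/e ≤ d ⟺ 𝔪_K^n ∣ 𝔇`**: the normalised order `d = differentOrd p K` of the different (`ord(p) = 1`;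
`𝔇 = 𝔪^δ`, `d = δ/e`, abc-iut-S1's `exists_different_eq_maximalIdeal_pow`) detects exactly the powers of `𝔪_K`
dividing `𝔇`. [cite: Mochizuki2012, IUTchIV Prop. 1.1 p. 9] -/
theorem div_le_differentOrd_iff_pow_dvd (n : ℕ) :
    (n : ℝ) / absRamificationIdx p K ≤ differentOrd p K ↔ maximalIdeal (Valued.integer K) ^ n ∣ different p K := by
  obtain ⟨δ, hδ, hd⟩ := exists_different_eq_maximalIdeal_pow p K
  have he : (0 : ℝ) < absRamificationIdx p K := by exact_mod_cast absRamificationIdx_pos p K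
  have hm0 : maximalIdeal (Valued.integer K) ≠ ⊥ := IsDiscreteValuationRing.not_a_field (Valued.integer K)
  have hm1 : ¬ IsUnit (maximalIdeal (Valued.integer K)) :=
    Ideal.isUnit_iff.not.mpr (IsLocalRing.maximalIdeal.isMaximal _).ne_top
  rw [hd, hδ, div_le_div_iff_of_pos_right he, Nat.cast_le, pow_dvd_pow_iff hm0 hm1]

/-- **`n/e ≤ d` through the local trace form** (the two preceding criteria combined).
[cite: SerreLocalFields1979, Ch. III §4 Prop. 10] -/
theorem div_le_differentOrd_iff_trace (n : ℕ) :
    (n : ℝ) / absRamificationIdx p K ≤ differentOrd p K ↔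
      ∀ z : K, (∀ b ∈ maximalIdeal (Valued.integer K) ^ n, ‖(b : K) * z‖ ≤ 1) →
        ∀ y : K, ‖y‖ ≤ 1 → ‖Algebra.trace ℚ_[p] K (z * y)‖ ≤ 1 := by
  rw [div_le_differentOrd_iff_pow_dvd, pow_maximalIdeal_dvd_different_iff_trace]

end Literature.IUT.LogVolume

end
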